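import Summits.HubbardSuperconductivity.HubbardSuperconductivity.Theorems.AnisotropyChordTransferFibre3FinXB2Eval

/-!
# Route `AnisotropyChord` / H0 rotor rung: FIN XB2 row-`N₁` certificate at `L = 30` — cell facts, part `r`

Kernel facts `xbCellAny2 30 (49/50) la lb c = true` (evaluator `…FinXB2Eval`, point wedges recomputed in the same `decide`) for 1 λ-cell(s) of the per-`L` cover
(`…FinXB2Cover.xbCheck2`; cell design: p3 g6 scratch `xb_design2.py`, float mirror `xb_mirror.py` (g5)); assembled in `…FinXB2Thirty`.
Prover seat `hubbard-h0-rotor-p3` g6; helper for piece A = stmt-HubbardSuperconductivity-23918 of rung 19089 (`--supports`, helper class).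
WHAT THIS IS NOT: nothing here proves superconductivity in the Hubbard model (rotor TARGET as worded stays FALSE, g15 verdict); kernel facts for the FIN certificate of ONE hypothesis (row `N₁`) of ONE conditional reduction.  Tree imports only; no sorry, no new axioms.
-/

set_option linter.dupNamespace false

namespace Summit.HubbardSuperconductivity.HubbardSuperconductivity.Theorems.AnisotropyChord.Transfer.Fibre3

namespace FinXB

set_option maxHeartbeats 4000000 in
/-- kernel fact: cell 33 at `L = 30` (certified, c = (9/20 : ℚ)). [folklore] -/
theorem xb2c30_33 : xbCellAny2 30 (49/50 : ℚ) 1336242413031710 1574511138305428 (9/20 : ℚ) = true := by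
  decide +kernel

end FinXB

end Summit.HubbardSuperconductivity.HubbardSuperconductivity.Theorems.AnisotropyChord.Transfer.Fibre3
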